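import Mathlib
import Literature.NumberTheory.Sieve.Maynard2016ClassCRT
import HarnessLib

/-!
# Maynard 2016: the CRT product rule for a finite system of periodic conditions

Topic `Literature/NumberTheory/Sieve`. J. Maynard, *Large gaps between primes*, Ann. of Math. (2)
183 (2016), 915–933 = arXiv:1408.5110, §6 displays (6.7)–(6.8) and (6.24)–(6.25): the `k` local
systems `d_j ∣ n + h_j q`, `e_j ∣ m(n + h_j q) − 1` (`j = 1, …, k`) have pairwise coprime moduli
(W-trick), so "by the Chinese remainder theorem" the number of solutions modulo `∏_j d_j e_j` is the
product of the local numbers of solutions (each `= 1`, `Maynard2016LocalSystem`).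

PROVED here (no named facts), for an arbitrary finite index set: a conjunction of `D_i`-periodic
conditions is `M`-periodic whenever every `D_i ∣ M` (`periodic_forall_of_dvd`), and for pairwise
coprime `D_i ≥ 1` the solution count modulo `∏ D_i` is the product of the local counts
(`card_filter_range_prod_of_pairwise_coprime`, by induction from
`card_filter_range_mul_of_coprime`).

## References

* J. Maynard, *Large gaps between primes*, Ann. of Math. (2) 183 (2016), 915–933; arXiv:1408.5110,
  §6 (6.7)–(6.8), (6.24)–(6.25). [Maynard2016LargeGaps]
-/

open Filter Finset
open scoped Topology

namespace Literature.NumberTheory.Sieve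

namespace Maynard2016

/-- A conjunction of `D_i`-periodic conditions (`i ∈ s`) is `M`-periodic if every `D_i ∣ M`. [cite: Maynard2016LargeGaps, §6 display (6.8)] -/
theorem periodic_forall_of_dvd {ι : Type*} (s : Finset ι) (D : ι → ℕ) (R : ι → ℕ → Prop)
    {M : ℕ} (hR : ∀ i ∈ s, Function.Periodic (R i) (D i)) (hM : ∀ i ∈ s, D i ∣ M) :
    Function.Periodic (fun n => ∀ i ∈ s, R i n) M := by
  intro n
  refine propext (forall₂_congr fun i hi => ?_)
  obtain ⟨t, ht⟩ := hM i hi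
  have h := (hR i hi).nsmul t n
  rw [smul_eq_mul] at h
  rw [ht, mul_comm (D i) t]
  exact Iff.of_eq h

/-- **CRT for a system.** For pairwise coprime `D_i ≥ 1` and `D_i`-periodic conditions `R_i`
(`i ∈ s`): `#{0 ≤ n < ∏ D_i : ∀ i, R_i n} = ∏_i #{0 ≤ b < D_i : R_i b}`. [cite: Maynard2016LargeGaps, §6 displays (6.7)–(6.8) («by the Chinese remainder theorem»)] -/
theorem card_filter_range_prod_of_pairwise_coprime {ι : Type*} [DecidableEq ι] (s : Finset ι)
    (D : ι → ℕ) (R : ι → ℕ → Prop) [∀ i, DecidablePred (R i)] (hD : ∀ i ∈ s, 0 < D i)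
    (hcop : (s : Set ι).Pairwise fun i j => (D i).Coprime (D j))
    (hR : ∀ i ∈ s, Function.Periodic (R i) (D i)) :
    ((Finset.range (∏ i ∈ s, D i)).filter (fun n => ∀ i ∈ s, R i n)).card =
      ∏ i ∈ s, ((Finset.range (D i)).filter (R i)).card := by
  induction s using Finset.induction_on with
  | empty => simp
  | insert a s has ih =>
    have hDa : 0 < D a := hD a (Finset.mem_insert_self _ _)
    have hDs : ∀ i ∈ s, 0 < D i := fun i hi => hD i (Finset.mem_insert_of_mem hi)
    have hRa : Function.Periodic (R a) (D a) := hR a (Finset.mem_insert_self _ _)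
    have hRs : ∀ i ∈ s, Function.Periodic (R i) (D i) :=
      fun i hi => hR i (Finset.mem_insert_of_mem hi)
    have hcops : (s : Set ι).Pairwise fun i j => (D i).Coprime (D j) :=
      hcop.mono (Finset.coe_subset.2 (Finset.subset_insert a s))
    have hprod : 0 < ∏ i ∈ s, D i := Finset.prod_pos hDs
    have hcop' : (D a).Coprime (∏ i ∈ s, D i) := by
      refine Nat.Coprime.prod_right fun i hi => ?_
      have hne : a ≠ i := fun h => has (h ▸ hi)
      exact hcop (Finset.mem_coe.2 (Finset.mem_insert_self a s))
        (Finset.mem_coe.2 (Finset.mem_insert_of_mem hi)) hne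
    have hper : Function.Periodic (fun n => ∀ i ∈ s, R i n) (∏ i ∈ s, D i) :=
      periodic_forall_of_dvd s D R hRs fun i hi => Finset.dvd_prod_of_mem _ hi
    rw [Finset.prod_insert has, Finset.prod_insert has, ← ih hDs hcops hRs,
      ← card_filter_range_mul_of_coprime hDa hprod hcop' (R a) (fun n => ∀ i ∈ s, R i n) hRa hper]
    congr 1
    ext n
    simp only [Finset.mem_filter, Finset.forall_mem_insert]

end Maynard2016

end Literature.NumberTheory.Sieve
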